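import Literature.NumberTheory.GaloisRepresentations.LubinTateColemanUnitsImageTraceTwo
import Literature.NumberTheory.GaloisRepresentations.LubinTateColemanCoordMomentsCoinvariantTwo
import Literature.NumberTheory.GaloisRepresentations.LubinTateColemanRelativeMomentsBaseChangeTwo
import HarnessLib

/-!
# The `X ↦ 0` specialisation of the `ℤ/d`-trace of the two-variable Coleman transform (`q = 2`): its level-`m` reading is
# `(Σ_σ σθ_m)⁻¹ · Σ_{σ ∈ Gal(E_m/F)} σ(r_{β,m})`, so its `k`-th MOMENT is the `Gal(E_m/F)`-trace of the `k`-th moment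
# (Coates–Wiles value) of the level-`m` coordinate `r_{β,m}`

De Shalit, *Iwasawa theory of elliptic curves with complex multiplication* (1987), Ch. I §3.5 (11) (the moments `D^k log g_β(0)`), §3.8
(16)–(17) (the two-variable algebra `Λ(𝒢; 𝒪) = 𝒪⟦X⟧⟦T⟧`, `1 + X ↔ φ`: evaluating `X ↦ 0` is integration against the TRIVIAL character of
the unramified direction `Gal(E_∞/F)`, i.e. the norm/trace to the bottom), Ch. III §1.3.  In the tree the two-variable transform
`Col β : ℤ/d → 𝒪_F⟦X⟧⟦Y⟧` of a coherent family `β = (β_m)_m` is characterised LEVELWISE by the Amice–CRT congruences `IsTransformProd`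
(`LubinTateColemanUnitsImageModuleTwo`) against the coordinates `r_{β,m} ∈ 𝒪_{E_m}⟦Y⟧` expressed in the normal integral basis
`(σθ_m)_σ`.  THIS file reads off the `X ↦ 0` specialisation of the `ℤ/d`-trace `Σ_j Col β (j)` (everything PROVED, 0 sorry, no definitions):

* §1 ★ `constantCoeff_sum_amiceSum` — `[X⁰] Σ_j Φ_m(y)(j) = Σ_{σ ∈ Gal(E_m/F)} a_y(σ)` (CRT + `φ` generates `Gal(E_m/F)`);
  `constantCoeff_sum_eq_of_isAmiceLevel`.
* §2 ★ `coordMoment_map_of_forall_eq` — the moments `mom_k` commute with every ring map of coefficient rings fixing `𝒪_F` (in particular with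
  `σ ∈ Gal(E/F)`: `coordMoment_map_unitBallEquiv`).
* §3 ★★ `C_sum_mul_specialization_eq_sum_map` — for `G = Col β`:
  **`C(Σ_σ σθ_m) · ι_m([X⁰] Σ_j G_j) = Σ_σ (r_{β,m})^σ`** in `𝒪_{E_m}⟦Y⟧` (`ι_m = algebraMap 𝒪_F 𝒪_{E_m}` coefficientwise);
  ★★★ **`sum_unitBallEquiv_mul_coordMoment_specialization`** — `(Σ_σ σθ_m) · mom_k(ι_m [X⁰] Σ_j G_j) = Σ_σ σ(mom_k(r_{β,m}))`: the
  moments of the specialised trace are the Galois traces of the Coates–Wiles moments of the level-`m` coordinates, up to the non-zero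
  factor `Tr θ_m`; `sum_unitBallEquiv_ne_zero` (`Σ_σ σθ_m ≠ 0`).

Sequel (`PAdicTwoVariableColemanImageNonvanishingOfMoment`): with the base change of `φ_ε` (`LubinTateColemanCoordBaseChangeTwo`) this turns the
(c)-capstone's analytic input `L_ε ≠ 0` into ONE non-vanishing Galois trace of a Coates–Wiles moment of `β_{a₁}`.

## References
* E. de Shalit, *Iwasawa theory of elliptic curves with complex multiplication* (1987), Ch. I §3.1, §3.5 (11), §3.8 (16)–(17); Ch. III §1.3. [deShalit1987]
* J.-P. Serre, *Local Fields* (1979), Ch. I §4 Prop. 10, Ch. II §2. [SerreLocalFields1979]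
-/

noncomputable section

namespace Literature.NumberTheory.GaloisRepresentations

section UnitsImageSpecializationTwo

open GaloisRepresentations.IsNonarchimedeanLocalField LubinTate ValuativeRel Field Finset

variable {F : Type} [Field F] [ValuativeRel F] [TopologicalSpace F] [IsNonarchimedeanLocalField F]

attribute [local instance] ltNormUniformSpace ltNormIsUniformAddGroup rk1 nF nE fintypeResidueField

variable {p : ℕ} [hp : Fact p.Prime] {d : ℕ} [NeZero d] (hd : d.Coprime p)
variable {π : 𝒪[F]} (hπ : (valuation F).IsUniformizer (π : F))
variable (E : ℕ → IntermediateField F (AlgebraicClosure F)) [∀ m, FiniteDimensional F (E m)] [∀ m, Normal F (E m)] [∀ m, IsGalois F (E m)]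
  (hmono : Monotone E) (hE : ∀ m, E m ≤ maxUnramified F) (hdeg : ∀ m, Module.finrank F (E m) = d * p ^ m)
  {σ₀ : absoluteGaloisGroup F} (hσ₀ : IsAbsArithFrob σ₀) (hq : residueFieldCard F = 2)
variable (u : (LTCoeff F)ˣ) (hu : LTCoeff.of F π = residueFieldCard F * u) (γ : 𝒪[F]ˣ)

/-! ### §1. The constant term of the summed Amice polynomials -/

omit [NeZero d] in
include hE hdeg hσ₀ in
/-- ★ **`[X⁰] Σ_{j ∈ ℤ/d} Φ_m(y)(j) = Σ_{σ ∈ Gal(E_m/F)} a_y(σ)`**: at `X = 0` every `(1+X)^i` is `1`, the double sum over `(j, i) ∈ ℤ/d × ℤ/p^m`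
is a sum over `ℤ/dp^m` (CRT), and `n ↦ φ^n` is a bijection onto `Gal(E_m/F)` (`frobPow_bijective_cyclic`). [cite: deShalit1987, Ch. I §3.1, §3.8 (16)–(17)] -/
theorem constantCoeff_sum_amiceSum [NeZero d] (m : ℕ) {θ : unitBall (E m)} (hθ : IsIntegralNormalGen (E m) θ) (y : unitBall (E m)) :
    PowerSeries.constantCoeff (∑ j : ZMod d, amiceSum p d hd σ₀ (E := E) hθ y j) = ∑ σ : E m ≃ₐ[F] E m, hθ.basis.repr y σ := by
  classical
  haveI : NeZero (p ^ m) := ⟨pow_ne_zero m hp.out.ne_zero⟩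
  haveI : NeZero (d * p ^ m) := ⟨mul_ne_zero (NeZero.ne d) (NeZero.ne (p ^ m))⟩
  set φ := (absoluteGaloisGroup.toAlgEquiv F σ₀).restrictNormal (E m) with hφ
  have h1 : PowerSeries.constantCoeff (∑ j : ZMod d, amiceSum p d hd σ₀ (E := E) hθ y j) =
      ∑ j : ZMod d, ∑ i : ZMod (p ^ m), hθ.basis.repr y (φ ^ ((ZMod.chineseRemainder (hd.pow_right m)).symm (j, i)).val) := by
    rw [map_sum]
    refine sum_congr rfl fun j _ => ?_
    unfold amiceSum
    rw [map_sum]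
    refine sum_congr rfl fun i _ => ?_
    simp only [map_mul, PowerSeries.constantCoeff_C, map_pow, map_add, map_one, PowerSeries.constantCoeff_X, add_zero, one_pow, mul_one]
    rfl
  have h2 : ∑ j : ZMod d, ∑ i : ZMod (p ^ m), hθ.basis.repr y (φ ^ ((ZMod.chineseRemainder (hd.pow_right m)).symm (j, i)).val) =
      ∑ M : ZMod (d * p ^ m), hθ.basis.repr y (φ ^ M.val) := by
    rw [← Fintype.sum_prod_type' (f := fun j i => hθ.basis.repr y (φ ^ ((ZMod.chineseRemainder (hd.pow_right m)).symm (j, i)).val))]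
    exact Fintype.sum_equiv (ZMod.chineseRemainder (hd.pow_right m)).symm.toEquiv _ _ fun q => rfl
  rw [h1, h2]
  exact Fintype.sum_bijective _ (frobPow_bijective_cyclic p d E hE hdeg hσ₀ m) _ _ fun M => rfl

omit hp [TopologicalSpace F] [IsNonarchimedeanLocalField F] in
/-- `[X⁰] ω_m = 0`. [cite: deShalit1987, Ch. I §3.8 (17)] -/
theorem constantCoeff_omega_eq_zero (m : ℕ) : PowerSeries.constantCoeff ((1 + PowerSeries.X : PowerSeries 𝒪[F]) ^ p ^ m - 1) = 0 := by
  simp only [map_sub, map_pow, map_add, map_one, PowerSeries.constantCoeff_X, add_zero, one_pow, sub_self]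

include hE hdeg hσ₀ in
/-- ★ **The constant term of the trace of a level-`m` Amice pair**: `IsAmiceLevel x y ⟹ [X⁰] Σ_j x j = Σ_σ a_y(σ)`.
[cite: deShalit1987, Ch. I §3.1, §3.8 (17)] -/
theorem constantCoeff_sum_eq_of_isAmiceLevel {m : ℕ} {θ : unitBall (E m)} {hθ : IsIntegralNormalGen (E m) θ} {x : ZMod d → PowerSeries 𝒪[F]}
    {y : unitBall (E m)} (hx : IsAmiceLevel p d hd σ₀ hθ x y) :
    PowerSeries.constantCoeff (∑ j : ZMod d, x j) = ∑ σ : E m ≃ₐ[F] E m, hθ.basis.repr y σ := by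
  rw [← constantCoeff_sum_amiceSum hd E hE hdeg hσ₀ m hθ y]
  have e : ∑ j : ZMod d, x j = ∑ j : ZMod d, amiceSum p d hd σ₀ (E := E) hθ y j + ∑ j : ZMod d, (x j - amiceSum p d hd σ₀ (E := E) hθ y j) := by
    rw [← sum_add_distrib]; exact sum_congr rfl fun j _ => by ring
  rw [e, map_add, add_eq_left, map_sum]
  refine sum_eq_zero fun j _ => ?_
  obtain ⟨c, hc⟩ := hx j
  rw [hc, map_mul, constantCoeff_omega_eq_zero, zero_mul]

/-! ### §2. The moments commute with ring maps of coefficients fixing `𝒪_F` -/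

/-- ★ **`mom_k(g^ψ) = ψ(mom_k(g))`** for every ring map `ψ : 𝒪_{E₁} → 𝒪_{E₂}` over `𝒪_F` (`Φ`, `D_E = ω_f·d/dX` and `[X⁰]` all have
coefficients from `𝒪_F`). [cite: deShalit1987, Ch. I §3.5 (11); Ch. III §1.3] -/
theorem coordMoment_map_of_forall_eq {E₁ E₂ : IntermediateField F (AlgebraicClosure F)} [FiniteDimensional F E₁] [FiniteDimensional F E₂]
    (ψ : unitBall E₁ →+* unitBall E₂) (hψ : ∀ a : LTCoeff F, ψ (algebraMap (LTCoeff F) (unitBall E₁) a) = algebraMap (LTCoeff F) (unitBall E₂) a)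
    (k : ℕ) (r : PowerSeries (unitBall E₁)) :
    coordMoment hπ E₂ u k (PowerSeries.map ψ r) = ψ (coordMoment hπ E₁ u k r) := by
  have hcomp : ψ.comp (algebraMap (LTCoeff F) (unitBall E₁)) = algebraMap (LTCoeff F) (unitBall E₂) := RingHom.ext hψ
  have hmap : ∀ g : PowerSeries (LTCoeff F), PowerSeries.map ψ (PowerSeries.map (algebraMap (LTCoeff F) (unitBall E₁)) g) =
      PowerSeries.map (algebraMap (LTCoeff F) (unitBall E₂)) g := fun g => by
    rw [← hcomp, PowerSeries.map_comp]; rfl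
  have hs : PowerSeries.HasSubst ((ltSer F π).map (algebraMap (LTCoeff F) (unitBall E₁))) :=
    PowerSeries.HasSubst.of_constantCoeff_zero' ((isLTSeries_ltSer π).map _).constantCoeff_eq_zero
  have hker : PowerSeries.map ψ (coordToKer hπ E₁ u r) = coordToKer hπ E₂ u (PowerSeries.map ψ r) := by
    unfold coordToKer
    have e : PowerSeries.map ψ (PowerSeries.subst ((ltSer F π).map (algebraMap (LTCoeff F) (unitBall E₁))) r) =
        PowerSeries.subst ((ltSer F π).map (algebraMap (LTCoeff F) (unitBall E₂))) (PowerSeries.map ψ r) := by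
      have e1 : PowerSeries.map ψ (PowerSeries.subst ((ltSer F π).map (algebraMap (LTCoeff F) (unitBall E₁))) r) =
          PowerSeries.subst (PowerSeries.map ψ ((ltSer F π).map (algebraMap (LTCoeff F) (unitBall E₁)))) (PowerSeries.map ψ r) :=
        PowerSeries.map_subst hs r
      rw [hmap] at e1
      exact e1
    rw [map_mul, map_add, map_one, map_mul, PowerSeries.map_C, hψ, PowerSeries.map_X, e]
  unfold coordMoment
  rw [← hker, iterate_mul_derivative_map_of_comp (algebraMap (LTCoeff F) (unitBall E₁)) (algebraMap (LTCoeff F) (unitBall E₂)) ψ hcomp,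
    ← PowerSeries.coeff_zero_eq_constantCoeff_apply, PowerSeries.coeff_map, PowerSeries.coeff_zero_eq_constantCoeff_apply]

/-- ★ `mom_k(r^σ) = σ(mom_k(r))` for `σ ∈ Gal(E/F)` acting on coefficients. [cite: deShalit1987, Ch. I §3.5 (11); Ch. III §1.3] -/
theorem coordMoment_map_unitBallEquiv {E₁ : IntermediateField F (AlgebraicClosure F)} [FiniteDimensional F E₁] (σ : E₁ ≃ₐ[F] E₁) (k : ℕ)
    (r : PowerSeries (unitBall E₁)) :
    coordMoment hπ E₁ u k (PowerSeries.map (unitBallEquiv E₁ σ : unitBall E₁ →+* unitBall E₁) r) = unitBallEquiv E₁ σ (coordMoment hπ E₁ u k r) :=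
  coordMoment_map_of_forall_eq hπ u (unitBallEquiv E₁ σ : unitBall E₁ →+* unitBall E₁) (fun a => (toUnitBallHom σ).commutes a) k r

/-! ### §3. The `X ↦ 0` specialisation of `Σ_j Col β (j)` read at level `m` -/

/-- ★ **`Σ_σ σ(y) = (Σ_ρ a_y(ρ)) · Σ_σ σθ`** for `y = Σ_ρ a_y(ρ)·ρθ` in the normal integral basis. [cite: SerreLocalFields1979, Ch. I §4 Prop. 10] -/
theorem sum_unitBallEquiv_eq_repr_sum_mul {E₁ : IntermediateField F (AlgebraicClosure F)} [FiniteDimensional F E₁] [IsGalois F E₁] {θ : unitBall E₁}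
    (hθ : IsIntegralNormalGen E₁ θ) (y : unitBall E₁) :
    ∑ σ : E₁ ≃ₐ[F] E₁, unitBallEquiv E₁ σ y =
      algebraMap 𝒪[F] (unitBall E₁) (∑ ρ : E₁ ≃ₐ[F] E₁, hθ.basis.repr y ρ) * ∑ σ : E₁ ≃ₐ[F] E₁, unitBallEquiv E₁ σ θ := by
  classical
  have hy : ∀ σ : E₁ ≃ₐ[F] E₁, unitBallEquiv E₁ σ y = ∑ ρ, hθ.basis.repr y ρ • unitBallEquiv E₁ (σ * ρ) θ := fun σ => by
    conv_lhs => rw [← hθ.basis.sum_repr y]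
    rw [map_sum]
    exact sum_congr rfl fun ρ _ => by rw [unitBallEquiv_smul, hθ.basis_apply, unitBallEquiv_mul_apply]
  simp_rw [hy]
  rw [sum_comm, map_sum, sum_mul]
  refine sum_congr rfl fun ρ _ => ?_
  rw [← smul_sum, Algebra.smul_def, mul_sum, mul_sum]
  exact Fintype.sum_equiv (Equiv.mulRight ρ) _ _ fun σ => rfl

variable [IsAdicComplete (Ideal.span {(p : 𝒪[F])}) 𝒪[F]]
variable {θ : ∀ m, unitBall (E m)} (hθ : ∀ m, IsIntegralNormalGen (E m) (θ m))
  (hcoh : ∀ m, unitBallTrace (hmono (Nat.le_succ m)) (θ (m + 1)) = θ m)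

include hdeg hE hσ₀ in
/-- ★★ **The level-`m` reading of the `X ↦ 0` specialisation of `Σ_j Col β (j)`**: with `G = Col β` and
`H_m := ι_m([X⁰] Σ_j G_j) ∈ 𝒪_{E_m}⟦Y⟧` (`ι_m = algebraMap 𝒪_F 𝒪_{E_m}` coefficientwise):
**`C(Σ_σ σθ_m) · H_m = Σ_{σ ∈ Gal(E_m/F)} (r_{β,m})^σ`** (coefficient `k`: `[X⁰] Σ_j [Y^k]G_j = Σ_ρ a(ρ)` by `IsTransformProd` + §1, and
`Σ_σ σ([Y^k] r) = (Σ_ρ a(ρ))·Σ_σ σθ`). [cite: deShalit1987, Ch. I §3.1, §3.8 (16)–(17); Ch. III §1.3] -/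
theorem C_sum_mul_specialization_eq_sum_map {β : ∀ m, RelNormCoherentUnits hπ (E m)}
    (hβ : ∀ m, (β (m + 1)).baseNorm hπ (hmono (Nat.le_succ m)) = β m) (m : ℕ) :
    PowerSeries.C (∑ σ : E m ≃ₐ[F] E m, unitBallEquiv (E m) σ (θ m)) *
        PowerSeries.map (algebraMap 𝒪[F] (unitBall (E m))) (PowerSeries.map (PowerSeries.constantCoeff (R := 𝒪[F]))
          (∑ j : ZMod d, TActModule.toPS (colemanImage hd hπ E hmono hE hdeg hσ₀ hq u hu γ hθ hcoh hβ j))) =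
      ∑ σ : E m ≃ₐ[F] E m, PowerSeries.map (unitBallEquiv (E m) σ : unitBall (E m) →+* unitBall (E m))
        (relUnitCoordTwo hπ (E m) hq (hE m) hσ₀ u hu (β m)) := by
  classical
  ext k
  have hT := isTransformProd_colemanImage hd hπ E hmono hE hdeg hσ₀ hq u hu γ hθ hcoh hβ m k
  have hc : PowerSeries.constantCoeff (PowerSeries.coeff k (∑ j : ZMod d, TActModule.toPS (colemanImage hd hπ E hmono hE hdeg hσ₀ hq u hu γ hθ hcoh hβ j))) =
      ∑ σ : E m ≃ₐ[F] E m, (hθ m).basis.repr (PowerSeries.coeff k (relUnitCoordTwo hπ (E m) hq (hE m) hσ₀ u hu (β m))) σ := by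
    rw [map_sum]
    exact constantCoeff_sum_eq_of_isAmiceLevel hd E hE hdeg hσ₀ hT
  rw [PowerSeries.coeff_C_mul, PowerSeries.coeff_map, PowerSeries.coeff_map, hc, map_sum (PowerSeries.coeff k), mul_comm]
  simp_rw [PowerSeries.coeff_map, RingHom.coe_coe]
  rw [sum_unitBallEquiv_eq_repr_sum_mul (hθ m) (PowerSeries.coeff k (relUnitCoordTwo hπ (E m) hq (hE m) hσ₀ u hu (β m)))]

include hdeg hE hσ₀ in
/-- ★★★ **THE MOMENTS OF THE SPECIALISED TRACE ARE THE GALOIS TRACES OF THE MOMENTS**: with `H_m = ι_m([X⁰] Σ_j Col β (j))`,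
**`(Σ_σ σθ_m) · mom_k(H_m) = Σ_{σ ∈ Gal(E_m/F)} σ(mom_k(r_{β,m}))`** — and `mom_k(r_{β,m})` is the `k`-th Coates–Wiles value of `β_m`
(`coordMoment_relUnitCoordTwo_eq_coatesWiles`). [cite: deShalit1987, Ch. I §3.5 (11), §3.8 (16)–(17); Ch. II §4.7 (15); Ch. III §1.3] -/
theorem sum_unitBallEquiv_mul_coordMoment_specialization {β : ∀ m, RelNormCoherentUnits hπ (E m)}
    (hβ : ∀ m, (β (m + 1)).baseNorm hπ (hmono (Nat.le_succ m)) = β m) (m k : ℕ) :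
    (∑ σ : E m ≃ₐ[F] E m, unitBallEquiv (E m) σ (θ m)) *
        coordMoment hπ (E m) u k (PowerSeries.map (algebraMap 𝒪[F] (unitBall (E m))) (PowerSeries.map (PowerSeries.constantCoeff (R := 𝒪[F]))
          (∑ j : ZMod d, TActModule.toPS (colemanImage hd hπ E hmono hE hdeg hσ₀ hq u hu γ hθ hcoh hβ j)))) =
      ∑ σ : E m ≃ₐ[F] E m, unitBallEquiv (E m) σ (coordMoment hπ (E m) u k (relUnitCoordTwo hπ (E m) hq (hE m) hσ₀ u hu (β m))) := by
  classical
  rw [← coordMoment_C_mul hπ (E m) u, C_sum_mul_specialization_eq_sum_map hd hπ E hmono hE hdeg hσ₀ hq u hu γ hθ hcoh hβ m]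
  have hsum : ∀ (s : Finset (E m ≃ₐ[F] E m)),
      coordMoment hπ (E m) u k (∑ σ ∈ s, PowerSeries.map (unitBallEquiv (E m) σ : unitBall (E m) →+* unitBall (E m))
        (relUnitCoordTwo hπ (E m) hq (hE m) hσ₀ u hu (β m))) =
      ∑ σ ∈ s, unitBallEquiv (E m) σ (coordMoment hπ (E m) u k (relUnitCoordTwo hπ (E m) hq (hE m) hσ₀ u hu (β m))) := by
    intro s
    induction s using Finset.induction_on with
    | empty => rw [sum_empty, sum_empty, coordMoment_zero]
    | insert σ s hσ ih => rw [sum_insert hσ, sum_insert hσ, coordMoment_add, ih, coordMoment_map_unitBallEquiv]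
  exact hsum univ

omit [NeZero d] hp [∀ m, Normal F (E m)] in
include hθ in
/-- **`Σ_σ σθ_m ≠ 0`** (it is `Tr_{E_m/F} θ_m`, and the conjugates of `θ_m` are linearly independent over `𝒪_F`).
[cite: SerreLocalFields1979, Ch. I §4 Prop. 10] -/
theorem sum_unitBallEquiv_ne_zero [CharZero F] (m : ℕ) : ∑ σ : E m ≃ₐ[F] E m, unitBallEquiv (E m) σ (θ m) ≠ 0 := by
  classical
  intro h
  have hli := (hθ m).linearIndependent
  have hrel : ∑ σ : E m ≃ₐ[F] E m, (1 : 𝒪[F]) • unitBallEquiv (E m) σ (θ m) = 0 := by simpa using h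
  have h1 := Fintype.linearIndependent_iff.mp hli (fun _ => (1 : 𝒪[F])) hrel 1
  exact one_ne_zero h1

end UnitsImageSpecializationTwo

end Literature.NumberTheory.GaloisRepresentations
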